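import Summits.PneNP.PneNP.Theorems.PairwiseSAPeeling
import Summits.PneNP.PneNP.Theorems.PstarSAPeelStep

/-!
# Biased pairwise-independent Sherali–Adams laws for `k`-local maps, II: the reweighted laws and the one-constraint peel (T22.0)

FRONTIER range-avoidance ladder, rung F-N3 context — restricted-model bookkeeping for the Sherali–Adams hierarchy
(`PstarSALevel.SAFeasible`); cell `pnp-ideate`, ROUND-22 item T22.0.  Nothing here bears on `P` vs `NP`.

The `k`-ary, law-abstract form of `PstarSAPeelStep`: for a biased pairwise-independent law system `(p, µ)`
(`PairwiseSALevel.PairwiseLaws`) the candidate Sherali–Adams laws are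

  `law I p µ S (x) = ∏_{j ∈ dom S} µ_j(x|vars j) · ∏_v ρ_{p v}(x_v)^{1 − deg_{dom S}(v)}`

(BGMT's `P_µ(S)` with the junction-tree reweighting; the bias-product law outside `S`).  This file: degrees, the weight `W`,
the laws, their sign and support, the ONE-CONSTRAINT PEEL `peel_step` (an output with `≥ k − 2` private variables sums out),
reusing the cylinder lemmas of `PstarSAPeelStep` (`sum_eq_of_cylOff`, …) which do not depend on the arity.
-/

set_option linter.dupNamespace false

open Finset Literature.Computability.Complexity
open Summit.PneNP.PneNP.Theorems.PstarPairwise (rho)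
open Summit.PneNP.PneNP.Theorems.PstarSALevel (varSet)
open Summit.PneNP.PneNP.Theorems.PstarSAPeeling (cylOff mem_cylOff sum_rho sum_cylOff_prod)
open Summit.PneNP.PneNP.Theorems.PairwiseSALevel (PairwiseLaws)

namespace Summit.PneNP.PneNP.Theorems.PairwiseSA

variable {k n m : ℕ}

/-! ## Degrees, the reweighted weight, the laws -/

/-- The number of outputs of `M` reading the variable `v`. -/
def deg (I : LocalMap k n m) (M : Finset (Fin m)) (v : Fin n) : ℕ := (M.filter fun j => v ∈ varSet I j).card

/-- The reweighting exponent `1 − deg_M(v)`. -/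
def ex (I : LocalMap k n m) (M : Finset (Fin m)) (v : Fin n) : ℤ := 1 - (deg I M v : ℤ)

/-- **The reweighted weight** of a set `M` of outputs at a full assignment. -/
noncomputable def W (I : LocalMap k n m) (p : Fin n → ℝ) (μ : Fin m → (Fin k → Bool) → ℝ) (M : Finset (Fin m))
    (x : Fin n → Bool) : ℝ :=
  (∏ j ∈ M, mu I μ j x) * ∏ v, rho (p v) (x v) ^ ex I M v

/-- The outputs DOMINATED by `S`: all their variables lie in `S`. -/
def dom (I : LocalMap k n m) (S : Finset (Fin n)) : Finset (Fin m) := univ.filter fun j => varSet I j ⊆ S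

/-- **The laws**: `law I p µ S` is the reweighted weight of the outputs dominated by `S`. -/
noncomputable def law (I : LocalMap k n m) (p : Fin n → ℝ) (μ : Fin m → (Fin k → Bool) → ℝ) (S : Finset (Fin n)) :
    (Fin n → Bool) → ℝ :=
  W I p μ (dom I S)

/-- Membership in `dom`. -/
theorem mem_dom {I : LocalMap k n m} {S : Finset (Fin n)} {j : Fin m} : j ∈ dom I S ↔ varSet I j ⊆ S := by
  simp [dom]

/-- `dom` is monotone. -/
theorem dom_mono (I : LocalMap k n m) {S T : Finset (Fin n)} (h : T ⊆ S) : dom I T ⊆ dom I S :=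
  fun _ hj => mem_dom.2 ((mem_dom.1 hj).trans h)

/-- The weights are nonnegative. -/
theorem W_nonneg {I : LocalMap k n m} {y : Fin m → Bool} {p : Fin n → ℝ} {μ : Fin m → (Fin k → Bool) → ℝ}
    (h : PairwiseLaws I y p μ) (M : Finset (Fin m)) (x : Fin n → Bool) : 0 ≤ W I p μ M x :=
  mul_nonneg (prod_nonneg fun j _ => h.nonneg j _)
    (prod_nonneg fun v _ => (zpow_pos (rho_pos_of (h.bias_pos v) (h.bias_lt_one v) _) _).le)

/-- The laws are nonnegative. -/
theorem law_nonneg {I : LocalMap k n m} {y : Fin m → Bool} {p : Fin n → ℝ} {μ : Fin m → (Fin k → Bool) → ℝ}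
    (h : PairwiseLaws I y p μ) (S : Finset (Fin n)) (x : Fin n → Bool) : 0 ≤ law I p μ S x :=
  W_nonneg h _ x

/-- **Support**: an output dominated by `S` takes the value `y j` wherever `law I p µ S` is nonzero. -/
theorem law_support {I : LocalMap k n m} {y : Fin m → Bool} {p : Fin n → ℝ} {μ : Fin m → (Fin k → Bool) → ℝ}
    (h : PairwiseLaws I y p μ) {S : Finset (Fin n)} {j : Fin m} (hj : varSet I j ⊆ S) {x : Fin n → Bool}
    (hx : law I p μ S x ≠ 0) : I.eval x j = y j := by
  have h' := left_ne_zero_of_mul hx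
  exact eval_eq_of_mu_ne_zero h (prod_ne_zero_iff.1 h' j (mem_dom.2 hj))

/-! ## Degrees under erasing one output; private variables -/

/-- Erasing `j₀` lowers the degree of exactly the variables of `j₀`, by one. -/
theorem deg_eq_deg_erase_add (I : LocalMap k n m) {M : Finset (Fin m)} {j₀ : Fin m} (hj₀ : j₀ ∈ M) (v : Fin n) :
    deg I M v = deg I (M.erase j₀) v + if v ∈ varSet I j₀ then 1 else 0 := by
  unfold deg
  rw [filter_erase]
  by_cases hv : v ∈ varSet I j₀
  · have hmem : j₀ ∈ M.filter (fun j => v ∈ varSet I j) := mem_filter.2 ⟨hj₀, hv⟩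
    rw [if_pos hv, card_erase_of_mem hmem]
    have hpos : 0 < (M.filter fun j => v ∈ varSet I j).card := card_pos.2 ⟨j₀, hmem⟩
    omega
  · have hnot : j₀ ∉ M.filter (fun j => v ∈ varSet I j) := fun h => hv (mem_filter.1 h).2
    rw [if_neg hv, erase_eq_of_notMem hnot, add_zero]

/-- The exponent shift under erasing `j₀`. -/
theorem ex_erase (I : LocalMap k n m) {M : Finset (Fin m)} {j₀ : Fin m} (hj₀ : j₀ ∈ M) (v : Fin n) :
    ex I (M.erase j₀) v = ex I M v + if v ∈ varSet I j₀ then 1 else 0 := by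
  unfold ex
  rw [deg_eq_deg_erase_add I hj₀ v]
  split_ifs <;> push_cast <;> ring

/-- The PRIVATE variables of `j₀` in `M`: read by `j₀` and by no other output of `M`. -/
def priv (I : LocalMap k n m) (M : Finset (Fin m)) (j₀ : Fin m) : Finset (Fin n) :=
  (varSet I j₀).filter fun v => ∀ j ∈ M, j ≠ j₀ → v ∉ varSet I j

/-- Private variables are variables of `j₀`. -/
theorem priv_subset (I : LocalMap k n m) (M : Finset (Fin m)) (j₀ : Fin m) : priv I M j₀ ⊆ varSet I j₀ :=
  filter_subset _ _

/-- A private variable is read by no other output of `M`. -/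
theorem not_mem_of_mem_priv {I : LocalMap k n m} {M : Finset (Fin m)} {j₀ j : Fin m} {v : Fin n} (hv : v ∈ priv I M j₀)
    (hj : j ∈ M) (hne : j ≠ j₀) : v ∉ varSet I j :=
  (mem_filter.1 hv).2 j hj hne

/-- After erasing `j₀`, a private variable of `j₀` has degree `0`. -/
theorem deg_erase_of_mem_priv {I : LocalMap k n m} {M : Finset (Fin m)} {j₀ : Fin m} {v : Fin n} (hv : v ∈ priv I M j₀) :
    deg I (M.erase j₀) v = 0 := by
  unfold deg
  rw [card_eq_zero, filter_eq_empty_iff]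
  intro j hj
  exact not_mem_of_mem_priv hv (mem_of_mem_erase hj) (ne_of_mem_erase hj)

/-- Exponent of a private variable after erasing `j₀`: `1`. -/
theorem ex_erase_of_mem_priv {I : LocalMap k n m} {M : Finset (Fin m)} {j₀ : Fin m} {v : Fin n} (hv : v ∈ priv I M j₀) :
    ex I (M.erase j₀) v = 1 := by
  unfold ex; rw [deg_erase_of_mem_priv hv]; rfl

/-- Exponent of a private variable of `j₀ ∈ M`: `0`. -/
theorem ex_of_mem_priv {I : LocalMap k n m} {M : Finset (Fin m)} {j₀ : Fin m} (hj₀ : j₀ ∈ M) {v : Fin n}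
    (hv : v ∈ priv I M j₀) : ex I M v = 0 := by
  have h := ex_erase I hj₀ v
  rw [ex_erase_of_mem_priv hv, if_pos (priv_subset I M j₀ hv)] at h
  linarith

/-! ## The one-constraint peel -/

/-- On a cylinder free on private variables of `j₀`, the other local factors are constant. -/
theorem prod_mu_erase_cyl {I : LocalMap k n m} (μ : Fin m → (Fin k → Bool) → ℝ) {M : Finset (Fin m)} {j₀ : Fin m}
    {F : Finset (Fin n)} (hF : F ⊆ priv I M j₀) {x β : Fin n → Bool} (hβ : β ∈ cylOff F x) :
    ∏ j ∈ M.erase j₀, mu I μ j β = ∏ j ∈ M.erase j₀, mu I μ j x := by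
  refine prod_congr rfl fun j hj => mu_congr I μ j fun v hv => ?_
  refine mem_cylOff.1 hβ v fun hvF => ?_
  exact not_mem_of_mem_priv (hF hvF) (mem_of_mem_erase hj) (ne_of_mem_erase hj) hv

/-- On a cylinder free on `F`, a reweighting product whose `F`-exponents vanish is constant. -/
theorem prod_zpow_cyl_of_zero (I : LocalMap k n m) (p : Fin n → ℝ) {M : Finset (Fin m)} {F : Finset (Fin n)}
    (h0 : ∀ v ∈ F, ex I M v = 0) {x β : Fin n → Bool} (hβ : β ∈ cylOff F x) :
    ∏ v, rho (p v) (β v) ^ ex I M v = ∏ v ∈ Fᶜ, rho (p v) (x v) ^ ex I M v := by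
  rw [← prod_mul_prod_compl F]
  rw [prod_eq_one fun v hv => by rw [h0 v hv, zpow_zero], one_mul]
  exact prod_congr rfl fun v hv => by rw [mem_cylOff.1 hβ v (mem_compl.1 hv)]

/-- On a cylinder free on `F`, a reweighting product whose `F`-exponents are `1` splits off `∏_{v ∈ F} ρ_v(β_v)`. -/
theorem prod_zpow_cyl_of_one (I : LocalMap k n m) (p : Fin n → ℝ) {M : Finset (Fin m)} {F : Finset (Fin n)}
    (h1 : ∀ v ∈ F, ex I M v = 1) {x β : Fin n → Bool} (hβ : β ∈ cylOff F x) :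
    ∏ v, rho (p v) (β v) ^ ex I M v = (∏ v ∈ F, rho (p v) (β v)) * ∏ v ∈ Fᶜ, rho (p v) (x v) ^ ex I M v := by
  rw [← prod_mul_prod_compl F]
  congr 1
  · exact prod_congr rfl fun v hv => by rw [h1 v hv, zpow_one]
  · exact prod_congr rfl fun v hv => by rw [mem_cylOff.1 hβ v (mem_compl.1 hv)]

/-- The exponent shift of `ex_erase`, multiplied out over the complement of `F`. -/
theorem prod_zpow_erase (I : LocalMap k n m) {p : Fin n → ℝ} (hp : ∀ v b, rho (p v) b ≠ 0) {M : Finset (Fin m)}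
    {j₀ : Fin m} (hj₀ : j₀ ∈ M) (F : Finset (Fin n)) (x : Fin n → Bool) :
    ∏ v ∈ Fᶜ, rho (p v) (x v) ^ ex I (M.erase j₀) v =
      (∏ v ∈ Fᶜ, rho (p v) (x v) ^ ex I M v) * ∏ v ∈ varSet I j₀ \ F, rho (p v) (x v) := by
  have h : ∀ v ∈ Fᶜ, rho (p v) (x v) ^ ex I (M.erase j₀) v =
      rho (p v) (x v) ^ ex I M v * (if v ∈ varSet I j₀ then rho (p v) (x v) else 1) := fun v _ => by
    rw [ex_erase I hj₀ v]
    split_ifs with hv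
    · rw [zpow_add_one₀ (hp v _)]
    · rw [add_zero, mul_one]
  rw [prod_congr rfl h, prod_mul_distrib, prod_ite_mem]
  congr 2
  ext v
  simp only [mem_inter, mem_compl, mem_sdiff]
  exact and_comm

/-- Summing the product of the biases of the free variables over a cylinder gives `1`. -/
theorem sum_cylOff_prod_rho (p : Fin n → ℝ) (F : Finset (Fin n)) (x : Fin n → Bool) :
    ∑ β ∈ cylOff F x, ∏ v ∈ F, rho (p v) (β v) = 1 := by
  rw [sum_cylOff_prod F x fun v b => rho (p v) b]
  exact prod_eq_one fun v _ => sum_rho _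

/-- **ONE-CONSTRAINT PEEL.**  If `j₀ ∈ M` has a set `F` of private variables leaving at most two of its slots outside `F`,
then summing the reweighted weight of `M` over the `F`-coordinates gives the same as for `M \ {j₀}`. -/
theorem peel_step {I : LocalMap k n m} {y : Fin m → Bool} {p : Fin n → ℝ} {μ : Fin m → (Fin k → Bool) → ℝ}
    (h : PairwiseLaws I y p μ) {M : Finset (Fin m)} {j₀ : Fin m} (hinj : Function.Injective (I.vars j₀)) (hj₀ : j₀ ∈ M)
    {F : Finset (Fin n)} (hF : F ⊆ priv I M j₀) (h2 : k ≤ F.card + 2) (x : Fin n → Bool) :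
    ∑ β ∈ cylOff F x, W I p μ M β = ∑ β ∈ cylOff F x, W I p μ (M.erase j₀) β := by
  have hp : ∀ v b, rho (p v) b ≠ 0 := fun v b => (rho_pos_of (h.bias_pos v) (h.bias_lt_one v) b).ne'
  have hFv : F ⊆ varSet I j₀ := hF.trans (priv_subset I M j₀)
  set R : ℝ := ∏ j ∈ M.erase j₀, mu I μ j x with hR
  set P : ℝ := ∏ v ∈ Fᶜ, rho (p v) (x v) ^ ex I M v with hP
  set G : ℝ := ∏ v ∈ varSet I j₀ \ F, rho (p v) (x v) with hG
  have hL : ∀ β ∈ cylOff F x, W I p μ M β = mu I μ j₀ β * (R * P) := fun β hβ => by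
    unfold W
    rw [← mul_prod_erase M _ hj₀, prod_mu_erase_cyl μ hF hβ,
      prod_zpow_cyl_of_zero I p (fun v hv => ex_of_mem_priv hj₀ (hF hv)) hβ]
    ring
  have hR' : ∀ β ∈ cylOff F x, W I p μ (M.erase j₀) β = (∏ v ∈ F, rho (p v) (β v)) * (R * (P * G)) := fun β hβ => by
    unfold W
    rw [prod_mu_erase_cyl μ hF hβ, prod_zpow_cyl_of_one I p (fun v hv => ex_erase_of_mem_priv (hF hv)) hβ,
      prod_zpow_erase I hp hj₀ F x]
    ring
  rw [sum_congr rfl hL, sum_congr rfl hR', ← sum_mul, ← sum_mul, sum_cylOff_mu h hinj hFv h2 x,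
    sum_cylOff_prod_rho, one_mul, ← hG]
  ring

end Summit.PneNP.PneNP.Theorems.PairwiseSA
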